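import Literature.NumberTheory.EllipticCurves.NoEverywhereGoodReductionRat
import Literature.NumberTheory.EllipticCurves.SupersingularPrimeFieldPointCount
import Literature.NumberTheory.EllipticCurves.ComplexMultiplicationDeuring1728Square
import HarnessLib

/-!
# `a₃ = 0` for a `j = 1728` curve over `ℚ` with good reduction at `3` (Deuring at the inert prime `3`, model-free)

Topic `NumberTheory/EllipticCurves`; namespace `Literature.NumberTheory.EllipticCurves.J1728`. THEOREMS ONLY — no
definition, no named fact, no instance (D-0014/D-0026). Twin of `JZeroGoodReductionTwoTraceProofs` (`j = 0`, `p = 2`).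

For an elliptic curve `E/ℚ` with `j(E) = 1728` (CM by `ℤ[i]`; the prime `3` is INERT in `ℚ(i)`) and good reduction at `3`,
the `3`rd coefficient of `L(E, s)` vanishes: `a₃(E) = 0`, i.e. `#Ẽ(𝔽₃) = 4` (supersingular reduction with trace zero —
there is no ideal of norm `3` in `ℤ[i]`). The tree's pointwise Deuring statement for `j = 1728`
(`frobeniusTrace_eq_zero_of_j_eq_of_mod_four_eq_three`, `ComplexMultiplicationDeuring1728Square`: Ireland–Rosen 18.5,
`x ↦ −x` on `y² = x³ − Dx`) goes through the short normal form and therefore EXCLUDES `p = 3`. Over `𝔽₃` the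
supersingular curves `y² = x³ + Bx + C` have `#E(𝔽₃) ∈ {1, 4, 7}` (Silverman Ex. V.5.10(c), tree
`DeuringHasse.zmod3_affine_counts`), so `j ≡ 1728 ≡ 0 (mod 3)` alone does NOT give `a₃ = 0`; the exact hypothesis
`j = 1728`, i.e. `c₆ = 0` over `ℤ`, does, by an elementary computation on the minimal equation (Silverman III.1):

* `three_dvd_b₂_of_c₆_eq_zero` — over `ℤ`, `c₆ = −b₂³ + 36b₂b₄ − 216b₆ = 0 ⟹ 3 ∣ b₂`;
* `cubic_eq_of_c₆_eq_zero` — with `b₂ = 3β`: `c₆ = 27(−β³ + 4βb₄ − 8b₆)`, so `c₆ = 0 ⟹ β³ = 4βb₄ − 8b₆`, whence modulo `3`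
  (`β³ ≡ β`): `β ≡ βb₄ + b₆`;
* `card_filter_eq_three` — over `𝔽₃`, every `y² + a₁xy + a₃y = x³ + a₂x² + a₄x + a₆` with `a₁² + 4a₂ = 0` admitting `β` with
  `−β³ + 4β(2a₄ + a₁a₃) − 8(a₃² + 4a₆) = 0` has exactly `3` affine points (completing the square, `y² = x³ − b₄x + b₆` and on
  `𝔽₃` the right-hand side is the function `(1 − b₄)x + b₆`: a bijection unless `b₄ = 1`, in which case `b₆ = 0`; `decide`);
* ★ `reductionPointCount_three_eq_four`, ★ `frobeniusTrace_three_eq_zero_of_j_eq_1728`, ★ `lFunction_three_eq_zero_of_j_eq_1728`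
  — for a globally minimal `W/ℚ` with `j(W) = 1728` and good reduction at `3`: `#W̃(𝔽₃) = 4`, `frobeniusTrace W 3 = 0`,
  `W.LFunction 3 = 0`;
* ★ `lFunction_eq_zero_of_j_eq_1728_of_mod_four_eq_three` — the merged all-`p` form: for EVERY good prime `p ≡ 3 (mod 4)`
  (now including `p = 3`), `W.LFunction p = 0`.

## References

* J. H. Silverman, *The Arithmetic of Elliptic Curves*, 2nd ed., GTM 106 (2009): III.1 (the quantities `b₂, b₄, b₆, c₆`),
  V.2 (`a = q + 1 − #E(𝔽_q)`), Exercise V.5.10(c), Exercise 8.19(a). [SilvermanAEC2009]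
* K. Ireland, M. Rosen, *A Classical Introduction to Modern Number Theory*, 2nd ed., GTM 84 (1990), Ch. 18 §4 Thm. 5
  (`y² = x³ − Dx`, `p ≡ 3 (mod 4)`: `N_p = p + 1`). [IrelandRosen1990]

## Mathlib / tree search

Mathlib: `WeierstrassCurve.c₆`, `b₂`, `b₄`, `b₆`, `@[simps] map`, `map_Δ`, `ZMod.intCast_zmod_eq_zero_iff_dvd`,
`Int.Prime.dvd_pow'`/`Prime.dvd_of_dvd_pow`. Tree: `c₄_pow_three_eq_of_j_eq` (`c₄³ = 1728Δ` for the minimal model,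
`ComplexMultiplicationDeuring1728Proofs`), `frobeniusTrace_eq_zero_of_j_eq_of_mod_four_eq_three` (odd `p ≠ 3`,
`ComplexMultiplicationDeuring1728Square`), `integralModelInt`, `reductionPointCount`, `frobeniusTrace` (`GlobalMinimalModel`),
`not_hasGoodReductionAtPrime_of_dvd_minimalDiscriminantInt` (`NoEverywhereGoodReductionRat`),
`LFunction_apply_prime_eq_frobeniusTrace` (`LFunctionPrimeCoeff`), `DeuringHasse.natCard_point_eq_card_filter_add_one`
(`SupersingularPrimeFieldPointCount`).
-/

noncomputable section

open scoped Classical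

open WeierstrassCurve Finset

namespace Literature.NumberTheory.EllipticCurves.J1728

/-! ### §1 Integer arithmetic of a Weierstrass equation with `c₆ = 0` -/

/-- `(a : ℤ/3) = 0 ⟺ 3 ∣ a` with the integer literal `3`. [cite: SilvermanAEC2009, III.1] -/
private theorem intCast_zmod_three_eq_zero_iff (a : ℤ) : ((a : ZMod 3) = 0) ↔ (3 : ℤ) ∣ a := by
  exact_mod_cast ZMod.intCast_zmod_eq_zero_iff_dvd a 3

/-- **`c₆ = 0 ⟹ 3 ∣ b₂`** over `ℤ`: `c₆ = −b₂³ + 36 b₂ b₄ − 216 b₆ ≡ −b₂³ (mod 3)`.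
[cite: SilvermanAEC2009, III.1 (c₆ = −b₂³ + 36 b₂ b₄ − 216 b₆)] -/
theorem three_dvd_b₂_of_c₆_eq_zero (V : WeierstrassCurve ℤ) (hc : V.c₆ = 0) : (3 : ℤ) ∣ V.b₂ := by
  have h3 : (3 : ℤ) ∣ V.b₂ ^ 3 := by
    have : V.b₂ ^ 3 = 3 * (12 * V.b₂ * V.b₄ - 72 * V.b₆) - V.c₆ := by
      simp only [WeierstrassCurve.c₆]; ring
    rw [this, hc, sub_zero]
    exact dvd_mul_right 3 _
  exact Int.Prime.dvd_pow' (by norm_num) h3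

/-- **With `b₂ = 3β`: `c₆ = 27(−β³ + 4βb₄ − 8b₆)`, so `c₆ = 0 ⟹ −β³ + 4βb₄ − 8b₆ = 0`.**
[cite: SilvermanAEC2009, III.1 (c₆)] -/
theorem cubic_eq_of_c₆_eq_zero (V : WeierstrassCurve ℤ) (hc : V.c₆ = 0) {β : ℤ} (hβ : V.b₂ = 3 * β) :
    -β ^ 3 + 4 * β * V.b₄ - 8 * V.b₆ = 0 := by
  have h27 : (27 : ℤ) * (-β ^ 3 + 4 * β * V.b₄ - 8 * V.b₆) = 0 := by
    rw [← hc]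
    simp only [WeierstrassCurve.c₆, hβ]
    ring
  exact (mul_eq_zero.mp h27).resolve_left (by norm_num)

/-! ### §2 The point count over `𝔽₃` -/

/-- **Over `𝔽₃`: three affine points.** Every `y² + a₁xy + a₃y = x³ + a₂x² + a₄x + a₆` over `𝔽₃` with `b₂ = a₁² + 4a₂ = 0`
and admitting `β ∈ 𝔽₃` with `−β³ + 4β·b₄ − 8·b₆ = 0` (`b₄ = 2a₄ + a₁a₃`, `b₆ = a₃² + 4a₆`) has exactly three affine
`𝔽₃`-points (complete the square: `y² = x³ − b₄x + b₆`, and `x ↦ x³ − b₄x + b₆ = (1 − b₄)x + b₆` is a bijection of `𝔽₃` unless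
`b₄ = 1`, when the relation forces `b₆ = 0`). Verified by `decide` over `𝔽₃⁶`. [cite: SilvermanAEC2009, V.2 and Exercise V.5.10(c)] -/
theorem card_filter_eq_three :
    ∀ a₁ a₂ a₃ a₄ a₆ β : ZMod 3, a₁ ^ 2 + 4 * a₂ = 0 →
      -β ^ 3 + 4 * β * (2 * a₄ + a₁ * a₃) - 8 * (a₃ ^ 2 + 4 * a₆) = 0 →
      (univ.filter fun xy : ZMod 3 × ZMod 3 =>
        xy.2 ^ 2 + a₁ * xy.1 * xy.2 + a₃ * xy.2 = xy.1 ^ 3 + a₂ * xy.1 ^ 2 + a₄ * xy.1 + a₆).card = 3 := by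
  decide

/-- **`#E(𝔽₃) = 4`** for an elliptic curve `E/𝔽₃` whose coefficients satisfy the two relations of `card_filter_eq_three`.
[cite: SilvermanAEC2009, V.2 and Exercise V.5.10(c)] -/
theorem natCard_point_eq_four (E : WeierstrassCurve (ZMod 3)) [E.IsElliptic] (hb : E.a₁ ^ 2 + 4 * E.a₂ = 0)
    {β : ZMod 3} (hβ : -β ^ 3 + 4 * β * (2 * E.a₄ + E.a₁ * E.a₃) - 8 * (E.a₃ ^ 2 + 4 * E.a₆) = 0) :
    Nat.card E.toAffine.Point = 4 := by
  rw [DeuringHasse.natCard_point_eq_card_filter_add_one E, card_filter_eq_three _ _ _ _ _ β hb hβ]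

/-! ### §3 Globally minimal `j = 1728` curves over `ℚ` with good reduction at `3` -/

variable (W : WeierstrassCurve ℚ) [W.IsElliptic] [W.IsGloballyMinimal]

/-- `j(W) = 1728 ⟹ c₆ = 0` for the integral model (`1728Δ = c₄³ − c₆²` and `c₄³ = 1728Δ`, tree `c₄_pow_three_eq_of_j_eq`).
[cite: SilvermanAEC2009, III.1 (1728 Δ = c₄³ − c₆²)] -/
theorem integralModelInt_c₆_eq_zero (hj : W.j = 1728) : (integralModelInt W).c₆ = 0 := by
  have h1 := c₄_pow_three_eq_of_j_eq W hj
  have h2 := (integralModelInt W).c_relation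
  have hsq : (integralModelInt W).c₆ ^ 2 = 0 := by linear_combination h1 + h2
  exact pow_eq_zero_iff (by norm_num) |>.mp hsq

omit [W.IsElliptic] in
/-- Good reduction at `3` ⟹ `3 ∤ Δ_min(W)`. [cite: SilvermanAEC2009, VII.5 Prop. 5.1(a) and VII.1 Prop. 1.3(b)] -/
theorem not_three_dvd_minimalDiscriminantInt [Fact (Nat.Prime 3)] (h : W.HasGoodReductionAtPrime 3) :
    ¬ (3 : ℤ) ∣ minimalDiscriminantInt W := fun hd =>
  not_hasGoodReductionAtPrime_of_dvd_minimalDiscriminantInt W 3 (by exact_mod_cast hd) h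

/-- ★ **`#W̃(𝔽₃) = 4` for a globally minimal `W/ℚ` with `j(W) = 1728` and good reduction at `3`.**
Ireland–Rosen Ch. 18 §4 Thm. 5 (`N_p = p + 1` for `y² = x³ − Dx`, `p ≡ 3 (mod 4)`), here at `p = 3` and for an arbitrary
minimal model. [cite: IrelandRosen1990, Ch. 18 §4, Theorem 5] -/
theorem reductionPointCount_three_eq_four [Fact (Nat.Prime 3)] (hj : W.j = 1728) (h : W.HasGoodReductionAtPrime 3) :
    reductionPointCount W 3 = 4 := by
  have hc := integralModelInt_c₆_eq_zero W hj
  have hΔ : ¬ (3 : ℤ) ∣ (integralModelInt W).Δ := not_three_dvd_minimalDiscriminantInt W h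
  obtain ⟨β, hβ⟩ := three_dvd_b₂_of_c₆_eq_zero _ hc
  have hcubic := cubic_eq_of_c₆_eq_zero _ hc hβ
  set E : WeierstrassCurve (ZMod 3) := (integralModelInt W).map (Int.castRingHom (ZMod 3)) with hE
  haveI : E.IsElliptic := by
    rw [isElliptic_iff, hE, map_Δ, isUnit_iff_ne_zero, eq_intCast, Ne, intCast_zmod_three_eq_zero_iff]
    exact hΔ
  -- the two relations, read in `𝔽₃`
  have hb : E.a₁ ^ 2 + 4 * E.a₂ = 0 := by
    have h0 : (((integralModelInt W).b₂ : ℤ) : ZMod 3) = 0 := by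
      rw [hβ]; push_cast; rw [show (3 : ZMod 3) = 0 from rfl]; ring
    simpa [hE, WeierstrassCurve.b₂] using h0
  have hβ' : -(β : ZMod 3) ^ 3 + 4 * (β : ZMod 3) * (2 * E.a₄ + E.a₁ * E.a₃) - 8 * (E.a₃ ^ 2 + 4 * E.a₆) = 0 := by
    have h0 : (((-β ^ 3 + 4 * β * (integralModelInt W).b₄ - 8 * (integralModelInt W).b₆ : ℤ)) : ZMod 3) = 0 := by
      rw [hcubic]; push_cast; ring
    simpa [hE, WeierstrassCurve.b₄, WeierstrassCurve.b₆] using h0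
  show Nat.card E.toAffine.Point = 4
  exact natCard_point_eq_four E hb hβ'

/-- ★ **`a₃(W) = 0`**: the trace of Frobenius at `3` of a globally minimal `W/ℚ` with `j(W) = 1728` and good reduction at
`3` vanishes (`3 + 1 − #W̃(𝔽₃) = 0`: supersingular reduction at the prime `3`, inert in the CM field `ℚ(i)`).
[cite: IrelandRosen1990, Ch. 18 §4, Theorem 5] -/
theorem frobeniusTrace_three_eq_zero_of_j_eq_1728 [Fact (Nat.Prime 3)] (hj : W.j = 1728)
    (h : W.HasGoodReductionAtPrime 3) : frobeniusTrace W 3 = 0 := by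
  rw [frobeniusTrace, reductionPointCount_three_eq_four W hj h]
  norm_num

/-- ★ **The `3`rd coefficient of `L(W, s)` vanishes** for a globally minimal `W/ℚ` with `j(W) = 1728` and good reduction at
`3` (`c_p = t_p`, Silverman Ex. 8.19(a); tree `LFunction_apply_prime_eq_frobeniusTrace`). [cite: IrelandRosen1990, Ch. 18 §4, Theorem 5] -/
theorem lFunction_three_eq_zero_of_j_eq_1728 [Fact (Nat.Prime 3)] (hj : W.j = 1728) (h : W.HasGoodReductionAtPrime 3) :
    W.LFunction 3 = 0 := by
  rw [W.LFunction_apply_prime_eq_frobeniusTrace 3 h, frobeniusTrace_three_eq_zero_of_j_eq_1728 W hj h]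

/-- ★ **`a_p(W) = 0` for EVERY good prime `p ≡ 3 (mod 4)` of a globally minimal `W/ℚ` with `j(W) = 1728`** — the primes
inert in the CM field `ℚ(i)`, now INCLUDING `p = 3`: the `p`-th coefficient of `L(W, s)` vanishes. The case `p ≠ 3` is the
tree's `frobeniusTrace_eq_zero_of_j_eq_of_mod_four_eq_three` (Ireland–Rosen 18.5), the case `p = 3` is
`lFunction_three_eq_zero_of_j_eq_1728`. [cite: IrelandRosen1990, Ch. 18 §4, Theorem 5] -/
theorem lFunction_eq_zero_of_j_eq_1728_of_mod_four_eq_three (hj : W.j = 1728) {p : ℕ} [Fact p.Prime]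
    (hp4 : p % 4 = 3) (h : W.HasGoodReductionAtPrime p) : W.LFunction p = 0 := by
  by_cases hp3 : p = 3
  · subst hp3
    exact lFunction_three_eq_zero_of_j_eq_1728 W hj h
  · have hΔ : ¬ (p : ℤ) ∣ minimalDiscriminantInt W := fun hd =>
      not_hasGoodReductionAtPrime_of_dvd_minimalDiscriminantInt W p hd h
    rw [W.LFunction_apply_prime_eq_frobeniusTrace p h,
      frobeniusTrace_eq_zero_of_j_eq_of_mod_four_eq_three W hj (Fact.out) hp4 hp3 hΔ]

end Literature.NumberTheory.EllipticCurves.J1728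

end
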